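import Summits.Ventures.LatticeQCDFlow.Scaling.TwoLevelRegimeFreeDoeblin

/-!
HONEST FRAMING: exact (Metropolis-corrected) sampling algorithms for lattice gauge theory; figures
of merit are autocorrelation/cost numbers at stated couplings and volumes; no continuum-physics
claim.

# TwoLevelCycleAutomaton — TWO GENERIC PIECES FOR SCHEDULE-CONDITIONED COLD-START LAWS: THE WORD EXPANSION `(Σ_a c_a κ_a)ⁿ =
# Σ_{|s|=n} (Π c_{s_i})·κ_{s_0}⋯κ_{s_{n−1}}` WITH THE CONVEXITY OF TOTAL VARIATION, AND THE THREE-STATE BOOKKEEPING AUTOMATON WHOSE EXPECTED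
# MULTIPLIER DECAYS LIKE `3·(1 − t·h·β/(2t+h))ⁿ` (lean-2 GEN-31, ours)

Venture-side (OURS).  Cell `lqcd-flow` (pub-lqcd), unit `pub-lqcd-lean-2-g31`, 2026-08-29.  Chapter R, file 3 (independent of files 1–2).  (1) A
kernel that is a mixture `Σ_a c_a κ_a` over a finite alphabet has `n`-th power equal to the mixture over WORDS `s ∈ Aⁿ` of the ordered products,
with weights `Π_i c_{s_i}` summing to `(Σ_a c_a)ⁿ`; total variation to a fixed law is convex along such mixtures.  (2) THE AUTOMATON of
`Scaling/TwoLevelCycleWords` with step probabilities `h` (redraw), `t` (ring), `1 − t − h` (idle) and multiplier `1 − β` at a redraw met in state `2`: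
with the potential `g = (h·g₁/(h−ρ), g₁, 1)`, `g₁ = t/(t−ρ)`, `ρ = t·h·β/(2t+h)`, one step satisfies `Σ_c c_c·mult(i,c)·g(δ(i,c)) ≤ (1−ρ)·g(i)` in
each state (state `2` is the binding one: `(h(1−β)+t)·t ≤ (t+h−ρ)(t−ρ) ⇔ ρ(2t+h) − ρ² ≤ t·h·β`), so the weighted sum of the running multiplier
over all words of length `n` is `≤ g₀·(1−ρ)ⁿ ≤ 3(1−ρ)ⁿ` (`β ≤ ½` gives `g₁ ≤ 2`, `g₀ ≤ 3`).

## What is proved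

* §1 **`mixture_pow_eq_sum_words`**, `sum_words_weight`, **`tvDist_sum_smul_le`**.
* §2 `cycle_mult_linear` (the running multiplier is linear in its start), **`cycle_mult_sum_le`** —
  `Σ_{s ∈ 3ⁿ} w(s)·Q(0,1,s) ≤ 3·(1 − t·h·β/(2t+h))ⁿ` (`0 < t`, `0 < h`, `t + h ≤ 1`, `0 ≤ β ≤ ½`).

Reading (no numerics implied): `ρ = t·h·β/(2t+h)` is, up to the factor `β`, the stationary frequency `t·h/(2t+h)` of "redraw closing an odd run" —
the same prefactor `th/(2t+h)` as chapter P's Boolean-star rate.  NOT CLAIMED: sharper constants (the exact Perron root).  Literature grade (cell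
rule): OWN, elementary; nothing cited as a fact; no new bib keys.
-/

noncomputable section

open Finset Function Matrix
open Literature.Probability.MarkovChains

namespace Summit.Ventures.LatticeQCDFlow.Scaling

variable {X : Type*} [Fintype X] [DecidableEq X]

/-! ## §1 Words: a mixture of kernels, iterated, is a mixture over words of kernel products -/

/-- **THE WORD EXPANSION:** `(Σ_a c_a·κ_a)ⁿ = Σ_{s ∈ Aⁿ} (Π_i c_{s_i})·κ_{s_0}κ_{s_1}⋯κ_{s_{n−1}}` (finite alphabet `A`). [ours] -/
theorem mixture_pow_eq_sum_words {A : Type*} [Fintype A] (c : A → ℝ) (κ : A → Matrix X X ℝ) (n : ℕ) :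
    (∑ a, c a • κ a) ^ n = ∑ s : Fin n → A, (∏ i, c (s i)) • ((List.ofFn s).map κ).prod := by
  induction n with
  | zero => simp
  | succ n ih =>
    rw [pow_succ', ih, Finset.mul_sum]
    simp_rw [Finset.sum_mul, Matrix.smul_mul, Matrix.mul_smul, smul_smul]
    rw [← (Fin.consEquiv (fun _ : Fin (n + 1) => A)).sum_comp, Fintype.sum_prod_type, Finset.sum_comm]
    refine sum_congr rfl fun s _ => sum_congr rfl fun a _ => ?_
    simp only [Fin.consEquiv_apply, Fin.prod_univ_succ, Fin.cons_zero, Fin.cons_succ, List.ofFn_succ,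
      List.map_cons, List.prod_cons]

/-- The word weights sum to `(Σ_a c_a)ⁿ`. [ours] -/
theorem sum_words_weight {A : Type*} [Fintype A] (c : A → ℝ) (n : ℕ) :
    ∑ s : Fin n → A, ∏ i, c (s i) = (∑ a, c a) ^ n := by
  rw [← Fin.prod_const n (∑ a, c a), Finset.prod_univ_sum, Fintype.piFinset_univ]

omit [DecidableEq X] in
/-- **Total variation is convex in the law:** `‖Σ_s w_s ν_s − π‖ ≤ Σ_s w_s ‖ν_s − π‖` for weights `w ≥ 0` with `Σ w = 1`. [ours] -/
theorem tvDist_sum_smul_le {ι : Type*} (T : Finset ι) (wgt : ι → ℝ) (hw : ∀ s ∈ T, 0 ≤ wgt s)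
    (hw1 : ∑ s ∈ T, wgt s = 1) (ν : ι → X → ℝ) (π : X → ℝ) :
    tvDist (fun y => ∑ s ∈ T, wgt s * ν s y) π ≤ ∑ s ∈ T, wgt s * tvDist (ν s) π := by
  unfold tvDist
  have hπ : ∀ y, π y = ∑ s ∈ T, wgt s * π y := fun y => by rw [← sum_mul, hw1, one_mul]
  calc (1 / 2 : ℝ) * ∑ y, |∑ s ∈ T, wgt s * ν s y - π y|
      = (1 / 2 : ℝ) * ∑ y, |∑ s ∈ T, wgt s * (ν s y - π y)| := by
        congr 1; refine sum_congr rfl fun y _ => ?_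
        rw [hπ y, ← sum_sub_distrib]
        simp_rw [mul_sub]
        rw [← hπ y]
    _ ≤ (1 / 2 : ℝ) * ∑ y, ∑ s ∈ T, wgt s * |ν s y - π y| := by
        refine mul_le_mul_of_nonneg_left (sum_le_sum fun y _ => (abs_sum_le_sum_abs _ _).trans
          (sum_le_sum fun s hs => ?_)) (by norm_num)
        rw [abs_mul, abs_of_nonneg (hw s hs)]
    _ = ∑ s ∈ T, wgt s * ((1 / 2 : ℝ) * ∑ y, |ν s y - π y|) := by
        rw [sum_comm, mul_sum]
        refine sum_congr rfl fun s _ => ?_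
        rw [mul_sum, mul_sum, mul_sum]
        exact sum_congr rfl fun y _ => by ring

/-! ## §2 The three-state bookkeeping automaton: the expected multiplier decays geometrically -/

/-- The running multiplier is linear in its start: `Q(i, q, s) = q·Q(i, 1, s)`. [ours] -/
theorem cycle_mult_linear (δ : Fin 3 → Fin 3 → Fin 3) (mult : Fin 3 → Fin 3 → ℝ) (s : List (Fin 3)) :
    ∀ (i : Fin 3) (q : ℝ), (s.foldl (fun st c => (δ st.1 c, st.2 * mult st.1 c)) (i, q)).2
      = q * (s.foldl (fun st c => (δ st.1 c, st.2 * mult st.1 c)) (i, 1)).2 ∧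
      (s.foldl (fun st c => (δ st.1 c, st.2 * mult st.1 c)) (i, q)).1
        = (s.foldl (fun st c => (δ st.1 c, st.2 * mult st.1 c)) (i, 1)).1 := by
  induction s with
  | nil => intro i q; exact ⟨(mul_one q).symm, rfl⟩
  | cons c s ih =>
    intro i q
    rw [List.foldl_cons, List.foldl_cons]
    have h1 := ih (δ i c) (q * mult i c)
    have h2 := ih (δ i c) (1 * mult i c)
    refine ⟨?_, h1.2.trans h2.2.symm⟩
    rw [h1.1, h2.1]; ring

/-- **THE EXPECTED MULTIPLIER DECAYS GEOMETRICALLY.**  With step probabilities `h` (hot redraw), `t` (ring), `z = 1 − t − h` (idle), the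
multiplier `1 − β` collected at each hot redraw met in state `2`, and the potential `g = (g₀, g₁, 1)`, `g₁ = t/(t−ρ)`, `g₀ = h·g₁/(h−ρ)`,
`ρ = t·h·β/(2t+h)`: `Σ_{|s| = n} w(s)·Q(i,1,s)·… ≤ (1−ρ)ⁿ·g_i`, hence from state `0`: **`Σ_{|s|=n} w(s)·Q(0,1,s) ≤ g₀·(1−ρ)ⁿ ≤ 3(1−ρ)ⁿ`**
(`0 < t`, `0 < h`, `t + h ≤ 1`, `0 ≤ β ≤ 1/2`). [ours] -/
theorem cycle_mult_sum_le {t h β : ℝ} (ht : 0 < t) (hh : 0 < h) (hth : t + h ≤ 1) (hβ0 : 0 ≤ β) (hβ1 : β ≤ 1 / 2)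
    (δ : Fin 3 → Fin 3 → Fin 3) (hδ0 : ∀ i, δ i 0 = 1) (hδ2 : ∀ i, δ i 2 = i) (hδ01 : δ 0 1 = 0) (hδ11 : δ 1 1 = 2)
    (hδ21 : δ 2 1 = 1)
    (mult : Fin 3 → Fin 3 → ℝ) (hmult : ∀ i c, mult i c = if i = 2 ∧ c = 0 then 1 - β else 1)
    (cw : Fin 3 → ℝ) (hc0 : cw 0 = h) (hc1 : cw 1 = t) (hc2 : cw 2 = 1 - t - h) (n : ℕ) :
    ∑ s : Fin n → Fin 3, (∏ j, cw (s j)) * ((List.ofFn s).foldl (fun st c => (δ st.1 c, st.2 * mult st.1 c)) (0, 1)).2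
      ≤ 3 * (1 - t * h * β / (2 * t + h)) ^ n := by
  set ρ : ℝ := t * h * β / (2 * t + h) with hρ
  have h2th : 0 < 2 * t + h := by linarith
  have hρt : ρ < t := by
    rw [hρ, div_lt_iff₀ h2th]; nlinarith [mul_nonneg ht.le hh.le]
  have hρh : ρ < h := by
    rw [hρ, div_lt_iff₀ h2th]; nlinarith [mul_nonneg ht.le hh.le]
  have hρ0 : 0 ≤ ρ := by rw [hρ]; positivity
  -- the potential
  set g : Fin 3 → ℝ := ![h * (t / (t - ρ)) / (h - ρ), t / (t - ρ), 1] with hg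
  have hg2 : g 2 = 1 := rfl
  have hg1 : g 1 = t / (t - ρ) := rfl
  have hg0 : g 0 = h * (t / (t - ρ)) / (h - ρ) := rfl
  have hg1_ge : 1 ≤ g 1 := by rw [hg1, le_div_iff₀ (by linarith)]; linarith
  have hg0_ge : g 1 ≤ g 0 := by
    rw [hg0, hg1, le_div_iff₀ (by linarith)]; nlinarith [div_nonneg ht.le (by linarith : (0 : ℝ) ≤ t - ρ)]
  have hρeq : ρ * (2 * t + h) = t * h * β := by rw [hρ]; field_simp
  have hg0_le : g 0 ≤ 3 := by
    -- `t/(t−ρ) ≤ 2` (from `2ρ ≤ t`) and then `h·2 ≤ 3(h−ρ)` (from `3ρ ≤ h`)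
    have h2ρ : 2 * ρ ≤ t := by nlinarith [mul_nonneg ht.le hh.le, mul_le_mul_of_nonneg_left hβ1 (mul_nonneg ht.le hh.le)]
    have h4ρ : 4 * ρ ≤ h := by nlinarith [mul_nonneg ht.le hh.le, mul_le_mul_of_nonneg_left hβ1 (mul_nonneg ht.le hh.le)]
    have h1 : t / (t - ρ) ≤ 2 := by rw [div_le_iff₀ (by linarith)]; linarith
    rw [hg0, div_le_iff₀ (by linarith)]
    nlinarith [mul_le_mul_of_nonneg_left h1 hh.le]
  -- the one-step potential inequality
  have hpot : ∀ i : Fin 3, ∑ c : Fin 3, cw c * mult i c * g (δ i c) ≤ (1 - ρ) * g i := by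
    have hfin3 : ∀ j : Fin 3, j = 0 ∨ j = 1 ∨ j = 2 := by decide
    intro i
    rw [Fin.sum_univ_three, hc0, hc1, hc2, hδ0, hδ2]
    rcases hfin3 i with rfl | rfl | rfl
    · rw [hδ01, hmult, hmult, hmult, if_neg (by decide), if_neg (by decide), if_neg (by decide), hg0, hg1]
      have htρ : 0 < t - ρ := by linarith
      have hhρ : 0 < h - ρ := by linarith
      rw [show h * 1 * (t / (t - ρ)) + t * 1 * (h * (t / (t - ρ)) / (h - ρ)) + (1 - t - h) * 1 * (h * (t / (t - ρ)) / (h - ρ))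
          = (1 - ρ) * (h * (t / (t - ρ)) / (h - ρ)) by field_simp; ring]
    · rw [hδ11, hmult, hmult, hmult, if_neg (by decide), if_neg (by decide), if_neg (by decide), hg1, hg2]
      have htρ : 0 < t - ρ := by linarith
      -- `h g₁ + t + z g₁ ≤ (1−ρ) g₁` iff `t ≤ (t − ρ) g₁ = t`
      rw [show h * 1 * (t / (t - ρ)) + t * 1 * 1 + (1 - t - h) * 1 * (t / (t - ρ)) = (1 - ρ) * (t / (t - ρ)) by
        field_simp; ring]
    · rw [hδ21, hmult, hmult, hmult, if_pos ⟨rfl, rfl⟩, if_neg (by decide), if_neg (by decide), hg1, hg2]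
      have htρ : 0 < t - ρ := by linarith
      -- `(h(1−β) + t)·g₁ + z ≤ 1 − ρ` with `g₁ = t/(t−ρ)`: `(h(1−β)+t)t ≤ (t+h−ρ)(t−ρ)` iff `ρ(2t+h) − ρ² ≤ thβ`
      rw [div_eq_mul_inv]
      have hinv : (t - ρ) * (t - ρ)⁻¹ = 1 := mul_inv_cancel₀ htρ.ne'
      have hkey : (h * (1 - β) + t) * t ≤ (t + h - ρ) * (t - ρ) := by
        have : ρ * (2 * t + h) = t * h * β := by rw [hρ]; field_simp
        nlinarith
      nlinarith [inv_pos.mpr htρ, mul_le_mul_of_nonneg_right hkey (inv_pos.mpr htρ).le]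
  -- induction over the length with every start state
  have hmain : ∀ n (i : Fin 3), ∑ s : Fin n → Fin 3, (∏ j, cw (s j))
      * ((List.ofFn s).foldl (fun st c => (δ st.1 c, st.2 * mult st.1 c)) (i, 1)).2 ≤ (1 - ρ) ^ n * g i := by
    intro n
    induction n with
    | zero =>
      intro i
      have h0 : ∑ s : Fin 0 → Fin 3, (∏ j, cw (s j))
          * ((List.ofFn s).foldl (fun st c => (δ st.1 c, st.2 * mult st.1 c)) (i, 1)).2 = 1 := by simp
      rw [h0, pow_zero, one_mul]
      rcases (by decide : ∀ j : Fin 3, j = 0 ∨ j = 1 ∨ j = 2) i with rfl | rfl | rfl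
      · exact hg1_ge.trans hg0_ge
      · exact hg1_ge
      · rw [hg2]
    | succ n ih =>
      intro i
      have hre : ∑ s : Fin (n + 1) → Fin 3, (∏ j, cw (s j))
            * ((List.ofFn s).foldl (fun st c => (δ st.1 c, st.2 * mult st.1 c)) (i, 1)).2
          = ∑ c : Fin 3, cw c * mult i c * ∑ s : Fin n → Fin 3, (∏ j, cw (s j))
            * ((List.ofFn s).foldl (fun st c => (δ st.1 c, st.2 * mult st.1 c)) (δ i c, 1)).2 := by
        rw [← (Fin.consEquiv (fun _ : Fin (n + 1) => Fin 3)).sum_comp, Fintype.sum_prod_type]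
        refine sum_congr rfl fun c _ => ?_
        rw [mul_sum]
        refine sum_congr rfl fun s _ => ?_
        have hcons : (Fin.consEquiv (fun _ : Fin (n + 1) => Fin 3)) (c, s) = Fin.cons c s := rfl
        rw [hcons, Fin.prod_univ_succ, Fin.cons_zero, List.ofFn_cons, List.foldl_cons]
        simp only [Fin.cons_succ]
        rw [(cycle_mult_linear δ mult (List.ofFn s) (δ i c) (1 * mult i c)).1]
        ring
      rw [hre]
      calc ∑ c : Fin 3, cw c * mult i c * ∑ s : Fin n → Fin 3, (∏ j, cw (s j))
            * ((List.ofFn s).foldl (fun st c => (δ st.1 c, st.2 * mult st.1 c)) (δ i c, 1)).2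
          ≤ ∑ c : Fin 3, cw c * mult i c * ((1 - ρ) ^ n * g (δ i c)) := by
            refine sum_le_sum fun c _ => mul_le_mul_of_nonneg_left (ih (δ i c)) ?_
            have hc : 0 ≤ cw c := by
              rcases (by decide : ∀ j : Fin 3, j = 0 ∨ j = 1 ∨ j = 2) c with rfl | rfl | rfl
              · rw [hc0]; exact hh.le
              · rw [hc1]; exact ht.le
              · rw [hc2]; linarith
            have hm : 0 ≤ mult i c := by rw [hmult]; split_ifs <;> linarith
            exact mul_nonneg hc hm
        _ = (1 - ρ) ^ n * ∑ c : Fin 3, cw c * mult i c * g (δ i c) := by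
            rw [mul_sum]; exact sum_congr rfl fun c _ => by ring
        _ ≤ (1 - ρ) ^ n * ((1 - ρ) * g i) :=
            mul_le_mul_of_nonneg_left (hpot i) (pow_nonneg (by linarith) n)
        _ = (1 - ρ) ^ (n + 1) * g i := by ring
  calc _ ≤ (1 - ρ) ^ n * g 0 := hmain n 0
    _ ≤ (1 - ρ) ^ n * 3 := mul_le_mul_of_nonneg_left hg0_le (pow_nonneg (by linarith) n)
    _ = 3 * (1 - ρ) ^ n := mul_comm _ _

end Summit.Ventures.LatticeQCDFlow.Scaling

end
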